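import Summits.QuantumFields.YangMills.Theorems.IR.AfPincerUcTypCluster
import Summits.QuantumFields.YangMills.Theorems.IR.AfPincerUcTypChainReduced
import HarnessLib

/-!
# Crux `IR` (stmt-QuantumFields-19354), line `af-pincer-Uc`: the CLUSTER-COUNT class `TypCluster` (2/3) — the cluster Peierls engine and
# clause (iii), THE TORUS ANCHOR, PROVED for the count class (seat ym-19354-afpincer-s1 g5)

Helper module for item `stmt-QuantumFields-19354` (`--supports stmt-QuantumFields-19354 --as helper`; it closes nothing; registry and
slot of record «sharp merge I♯_SC» `Cruxes/IR/Lines/af_pincer_Uc_sharp.lean` sha16 `28967a1bf60ad397` UNTOUCHED; open stub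
`stub_onsetSharpSC : AfPincerUc.SharpOnset.OnsetSharpUKPcSC`).  Part 1/3 (`AfPincerUcTypCluster`) typed the count class
`TypCluster ρ θ w k c` (no `θ`-bad walk of `≤ 2k` steps through `k + 1` distinct own plaquettes — walls read at every scale BY COUNT) with its
bookkeeping, `TypCluster θ k ⊆ TypChain θ ℓ₀` (`2k ≤ ℓ₀ + 1`) and R109 (3).  THIS FILE:

* §1 **`measure_forall_hasBadClusterAmong_le_pow` — the abstract hereditary CLUSTER Peierls bound**: for ANY measure `μ` read through ANY
  `Φ : Ω → LGConfig 4 G`, pairwise disjoint cells `P c` (`c ∈ F`) of `≤ n` plaquettes inside a universe `𝒰`, and the chessboard-shaped sparseness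
  `μ{∀ p ∈ X, θ ≤ plaqAction ρ p ∘ Φ} ≤ q ^ #X` for `X ⊆ 𝒰` (`0 ≤ q ≤ 1`, NO smallness condition): `μ{∀ c ∈ F, HasBadClusterAmong ρ θ (P c) k ∘ Φ} ≤
  ((2k+1) n 3750^{2k} q^{k+1}) ^ #F` (induction on `F` uniformly in an extra bad set, as S1 g2's `measure_forall_hasBadChainAmong_le_pow`; walks of
  `m ≤ 2k` steps from `P c` number `≤ n 3750^m`, `exists_chainFinset`; a walk's `≥ k + 1` visited plaquettes are disjoint from the extra set and from
  the other cells, so the exponents add; all sums FINITE — no geometric series, no `3750 q ≤ 1/2`).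
* §2 **`clauseIII_typCluster` (PROVED)** from the tree's torus sparseness `torus_plaqSet_sparse_exp` (Fröhlich–Israel–Lieb–Simon chessboard,
  `q = e^{−θβ/12}`) with the explicit budget `(2k+1) · 96 b⁴ · 3750^{2k} · q^{k+1} ≤ δ`; `clusterBudget` (the arithmetic ONCE: a count `k ≥ 4C⁺/κ`
  meets any such budget at every mesh `b ≤ B e^{Cβ}` for large `β`, since `e^{4C⁺β} (e^{−κβ})^{k+1} ≤ e^{−κβ}`); **`clauseIII_typCluster_expMesh`**
  (supplier order: EVERY count `k ≥ halfExtent (θ/12) C = ⌈48 C⁺/θ⌉₊` serves every `δ > 0` and every prefactor `B`).  The Peierls floor of the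
  count class is thus the COUNT `halfExtent`, half the extent floor `extentOf` of the class of record — same arithmetic, different currency.
Sequel (3/3, `AfPincerUcTypClusterReduced`): clause (ii) reduced by name, the supplier targets, and the free re-cut
`TypChainReducedAtSC → TypClusterReducedAtSC`.

HONEST FRAMING: Peierls bookkeeping around ONE open stub of a CONDITIONAL chain (Track A 0/28 UV); one SOFT conjunct ((iii)) of a supplier format
is discharged for the count class; nothing of weak-coupling mixing, asymptotic freedom or a gap is proved or claimed; not infinite volume, not
Clay.  No `sorry`; axioms ⊆ {propext, Classical.choice, Quot.sound}; no instances, no notation.  References: R. Peierls, Proc. Camb. Phil. Soc.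
32 (1936) 477; Fröhlich–Israel–Lieb–Simon, CMP 62 (1978) Thm 4.1; E. Seiler, LNP 159 (1982) Ch. 3–4; G. Grimmett, Percolation §4.2.
-/

set_option autoImplicit false

noncomputable section

open Filter Topology MeasureTheory
open Literature.MathematicalPhysics.QuantumFieldTheory hiding ZdEdge
open Literature.MathematicalPhysics.QuantumLattice
open Literature.Probability.LatticeModels (Site)
open Summit.QuantumFields.YangMills.Cruxes.OSLegsFromFemtoAndGap.DlrCollarTransfer (LowerBounds)
open Summit.QuantumFields.YangMills.Cruxes.IR.Tempered (regionEdges)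
open Summit.QuantumFields.YangMills.Theorems.OddTorusChessboard (cellPlaqs plaqAction cellSites
  fst_mem_cellSites_of_mem_cellPlaqs cellSites_subset_box card_cellPlaqs_le card_orient_four)

namespace Summit.QuantumFields.YangMills.Cruxes.IR.AfPincerUc.SharpLanes

open Summit.QuantumFields.YangMills.Cruxes.IR.AfPincerUc

/-! ## §1 The abstract hereditary cluster Peierls bound (finite sums; no smallness of the base) -/
section Peierls

variable {G : Type} [Group G] {N : ℕ} (ρ : G →* Matrix (Fin N) (Fin N) ℂ)
variable {Ω : Type*} [MeasurableSpace Ω]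

/-- **Abstract hereditary CLUSTER Peierls bound.**  `μ` any measure on data read through `Φ : Ω → LGConfig 4 G`, `θ` a threshold, `(P c)_{c ∈ F}`
pairwise DISJOINT plaquette sets inside a finite universe `𝒰`, each with `≤ n` plaquettes; SPARSENESS: `μ{∀ p ∈ X, θ ≤ plaqAction ρ p (Φ ω)} ≤ q ^ #X`
for every `X ⊆ 𝒰`, `0 ≤ q ≤ 1`.  CONCLUSION: «EVERY cell `P c`, `c ∈ F`, carries a `θ`-bad cluster of more than `k` plaquettes» (`HasBadClusterAmong`)
has `μ`-measure `≤ η ^ #F`, `η = (2k+1) · n · 3750^{2k} · q^{k+1}`.  Proof: induction on the family uniformly in an extra set `X` required bad; the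
new cell's cluster walk (`m ≤ 2k` steps, `≤ n · 3750^m` of them) visits `≥ k + 1` plaquettes of its cell, disjoint from `X` and the other cells. -/
theorem measure_forall_hasBadClusterAmong_le_pow (μ : Measure Ω) (Φ : Ω → LGConfig 4 G) (θ : ℝ)
    {ι : Type*} (F : Finset ι) (P : ι → Finset (ZdPlaquette 4)) (𝒰 : Finset (ZdPlaquette 4))
    (hP𝒰 : ∀ c ∈ F, P c ⊆ 𝒰) (hdisj : ∀ c ∈ F, ∀ c' ∈ F, c ≠ c' → Disjoint (P c) (P c'))
    {n : ℕ} (hn : ∀ c ∈ F, (P c).card ≤ n) {q : ℝ} (hq0 : 0 ≤ q) (hq1 : q ≤ 1)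
    (hsp : ∀ X : Finset (ZdPlaquette 4), X ⊆ 𝒰 →
      μ {ω | ∀ p ∈ X, θ ≤ plaqAction ρ p (Φ ω)} ≤ ENNReal.ofReal (q ^ X.card))
    (k : ℕ) :
    μ {ω | ∀ c ∈ F, HasBadClusterAmong ρ θ (↑(P c)) k (Φ ω)} ≤
      ENNReal.ofReal ((((2 * k + 1 : ℕ) : ℝ) * n * 3750 ^ (2 * k) * q ^ (k + 1)) ^ F.card) := by
  classical
  set η : ℝ := ((2 * k + 1 : ℕ) : ℝ) * n * 3750 ^ (2 * k) * q ^ (k + 1) with hη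
  have hη0 : 0 ≤ η := by positivity
  suffices key : ∀ F' : Finset ι, F' ⊆ F → ∀ X : Finset (ZdPlaquette 4), X ⊆ 𝒰 → (∀ c ∈ F', Disjoint X (P c)) →
      μ {ω | (∀ p ∈ X, θ ≤ plaqAction ρ p (Φ ω)) ∧ ∀ c ∈ F', HasBadClusterAmong ρ θ (↑(P c)) k (Φ ω)} ≤
        ENNReal.ofReal (q ^ X.card * η ^ F'.card) by
    have h := key F subset_rfl ∅ (Finset.empty_subset _) (fun c _ => Finset.disjoint_empty_left _)
    rw [Finset.card_empty, pow_zero, one_mul] at h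
    refine (measure_mono ?_).trans h
    intro ω hω
    exact ⟨fun p hp => absurd hp (Finset.notMem_empty p), hω⟩
  intro F'
  induction F' using Finset.induction_on with
  | empty =>
    intro _ X hX _
    rw [Finset.card_empty, pow_zero, mul_one]
    refine (measure_mono ?_).trans (hsp X hX)
    intro ω hω
    exact hω.1
  | insert a s ha ih =>
    intro hsub X hX hdX
    have haF : a ∈ F := hsub (Finset.mem_insert_self a s)
    have hsF : s ⊆ F := fun c hc => hsub (Finset.mem_insert_of_mem hc)
    -- walk Finsets from the start set `P a`, one per length `m`
    choose T hTcard hTmem using fun m : ℕ => exists_chainFinset (P a) m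
    -- the events «the admissible walk `ch` is entirely bad, `X` is bad, the cells of `s` carry clusters»
    let E : (m : ℕ) → (Fin (m + 1) → ZdPlaquette 4) → Set Ω := fun m ch =>
      {ω | ((∀ i, ch i ∈ P a) ∧ k + 1 ≤ (Finset.univ.image ch).card) ∧
        (∀ p ∈ X ∪ Finset.univ.image ch, θ ≤ plaqAction ρ p (Φ ω)) ∧
          ∀ c ∈ s, HasBadClusterAmong ρ θ (↑(P c)) k (Φ ω)}
    -- (1) covering
    have hcover : {ω | (∀ p ∈ X, θ ≤ plaqAction ρ p (Φ ω)) ∧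
        ∀ c ∈ insert a s, HasBadClusterAmong ρ θ (↑(P c)) k (Φ ω)} ⊆
          ⋃ m ∈ Finset.range (2 * k + 1), ⋃ ch ∈ T m, E m ch := by
      rintro ω ⟨hXω, hcl⟩
      obtain ⟨m, c, hm, hin, hbad, hstep, hcard⟩ := hcl a (Finset.mem_insert_self a s)
      refine Set.mem_iUnion₂.2 ⟨m, Finset.mem_range.2 (by omega), Set.mem_iUnion₂.2 ⟨c,
        hTmem m c (Finset.mem_coe.1 (hin 0)) hstep, ?_⟩⟩
      refine ⟨⟨fun i => Finset.mem_coe.1 (hin i), hcard⟩, fun p hp => ?_, fun c' hc' => hcl c' (Finset.mem_insert_of_mem hc')⟩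
      rcases Finset.mem_union.1 hp with hpX | hpI
      · exact hXω p hpX
      · obtain ⟨i, -, rfl⟩ := Finset.mem_image.1 hpI
        exact hbad i
    -- (2) each event: empty, or the induction hypothesis at `X ∪ image ch`
    have hE : ∀ (m : ℕ) (ch : Fin (m + 1) → ZdPlaquette 4),
        μ (E m ch) ≤ ENNReal.ofReal (q ^ X.card * q ^ (k + 1) * η ^ s.card) := by
      intro m ch
      by_cases hadm : (∀ i, ch i ∈ P a) ∧ k + 1 ≤ (Finset.univ.image ch).card
      · have himg : Finset.univ.image ch ⊆ P a := by
          intro p hp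
          obtain ⟨i, -, rfl⟩ := Finset.mem_image.1 hp
          exact hadm.1 i
        have hX' : X ∪ Finset.univ.image ch ⊆ 𝒰 := Finset.union_subset hX (himg.trans (hP𝒰 a haF))
        have hdX' : ∀ c ∈ s, Disjoint (X ∪ Finset.univ.image ch) (P c) := by
          intro c hc
          have hac : a ≠ c := fun h => ha (h ▸ hc)
          exact Finset.disjoint_union_left.2
            ⟨hdX c (Finset.mem_insert_of_mem hc), (hdisj a haF c (hsF hc) hac).mono_left himg⟩
        have hcardX' : X.card + (k + 1) ≤ (X ∪ Finset.univ.image ch).card := by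
          rw [Finset.card_union_of_disjoint ((hdX a (Finset.mem_insert_self a s)).mono_right himg)]
          exact Nat.add_le_add_left hadm.2 _
        have e : E m ch = {ω | (∀ p ∈ X ∪ Finset.univ.image ch, θ ≤ plaqAction ρ p (Φ ω)) ∧
            ∀ c ∈ s, HasBadClusterAmong ρ θ (↑(P c)) k (Φ ω)} := by
          ext ω
          simp only [E, Set.mem_setOf_eq]
          exact ⟨fun h => h.2, fun h => ⟨hadm, h⟩⟩
        rw [e]
        refine (ih hsF _ hX' hdX').trans (ENNReal.ofReal_le_ofReal ?_)
        rw [← pow_add]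
        exact mul_le_mul_of_nonneg_right (pow_le_pow_of_le_one hq0 hq1 hcardX') (pow_nonneg hη0 _)
      · have e : E m ch = ∅ := Set.eq_empty_of_forall_notMem fun ω hω => hadm hω.1
        rw [e, measure_empty]
        exact bot_le
    -- (3) counting, length by length
    have hcard : ∀ m ∈ Finset.range (2 * k + 1),
        ((T m).card : ENNReal) * ENNReal.ofReal (q ^ X.card * q ^ (k + 1) * η ^ s.card) ≤
          ENNReal.ofReal (n * 3750 ^ (2 * k) * (q ^ X.card * q ^ (k + 1) * η ^ s.card)) := by
      intro m hm
      rw [← ENNReal.ofReal_natCast, ← ENNReal.ofReal_mul (by positivity)]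
      refine ENNReal.ofReal_le_ofReal (mul_le_mul_of_nonneg_right ?_ (by positivity))
      have hm' : m ≤ 2 * k := by have := Finset.mem_range.1 hm; omega
      have h' : ((T m).card : ℝ) ≤ (P a).card * 3750 ^ m := by exact_mod_cast hTcard m
      have hn' : ((P a).card : ℝ) ≤ n := by exact_mod_cast hn a haF
      have hp : (3750 : ℝ) ^ m ≤ 3750 ^ (2 * k) := pow_le_pow_right₀ (by norm_num) hm'
      calc ((T m).card : ℝ) ≤ (P a).card * 3750 ^ m := h'
        _ ≤ n * 3750 ^ (2 * k) := by gcongr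
    -- (4) summation (finite)
    have hμ : μ (⋃ m ∈ Finset.range (2 * k + 1), ⋃ ch ∈ T m, E m ch) ≤
        ENNReal.ofReal (((2 * k + 1 : ℕ) : ℝ) * (n * 3750 ^ (2 * k) * (q ^ X.card * q ^ (k + 1) * η ^ s.card))) :=
      calc μ (⋃ m ∈ Finset.range (2 * k + 1), ⋃ ch ∈ T m, E m ch)
          ≤ ∑ m ∈ Finset.range (2 * k + 1), μ (⋃ ch ∈ T m, E m ch) := measure_biUnion_finset_le _ _
        _ ≤ ∑ m ∈ Finset.range (2 * k + 1), ∑ ch ∈ T m, μ (E m ch) :=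
          Finset.sum_le_sum fun m _ => measure_biUnion_finset_le _ _
        _ ≤ ∑ m ∈ Finset.range (2 * k + 1), ∑ ch ∈ T m, ENNReal.ofReal (q ^ X.card * q ^ (k + 1) * η ^ s.card) :=
          Finset.sum_le_sum fun m _ => Finset.sum_le_sum fun ch _ => hE m ch
        _ = ∑ m ∈ Finset.range (2 * k + 1), ((T m).card : ENNReal) * ENNReal.ofReal (q ^ X.card * q ^ (k + 1) * η ^ s.card) := by
          simp only [Finset.sum_const, nsmul_eq_mul]
        _ ≤ ∑ m ∈ Finset.range (2 * k + 1), ENNReal.ofReal (n * 3750 ^ (2 * k) * (q ^ X.card * q ^ (k + 1) * η ^ s.card)) :=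
          Finset.sum_le_sum hcard
        _ = ENNReal.ofReal (((2 * k + 1 : ℕ) : ℝ) * (n * 3750 ^ (2 * k) * (q ^ X.card * q ^ (k + 1) * η ^ s.card))) := by
          rw [Finset.sum_const, Finset.card_range, nsmul_eq_mul, ← ENNReal.ofReal_natCast,
            ← ENNReal.ofReal_mul (Nat.cast_nonneg _)]
    refine ((measure_mono hcover).trans hμ).trans (ENNReal.ofReal_le_ofReal (le_of_eq ?_))
    rw [Finset.card_insert_of_notMem ha, pow_succ, hη]
    ring

end Peierls

/-! ## §2 Clause (iii) — the torus anchor — for `TypCluster`, PROVED; the budget arithmetic at exponential meshes -/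
section Torus

variable {G : Type} [Group G] [TopologicalSpace G] [IsTopologicalGroup G] [CompactSpace G]
  [MeasurableSpace G] [BorelSpace G]

/-- **CLAUSE (iii) — THE TORUS ANCHOR — FOR THE COUNT CLASS `TypCluster` (PROVED), explicit budget.**  For `r` and `θ > 0` there is `β₁` such that
for every `β ≥ β₁`, every mesh `b ≥ 1`, every count `k` and every `δ` with `(2k+1) · 96 b⁴ · 3750^{2k} · q^{k+1} ≤ δ`, `q = e^{−θβ/12}`, the family
`TypCluster r.ρ θ w k` satisfies `ClauseIII r.ρ β w b δ` on every mesh-`b` frame `w` (cluster Peierls bound over `torus_plaqSet_sparse_exp`). -/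
theorem clauseIII_typCluster (r : LatticeRep G) {θ : ℝ} (hθ : 0 < θ) :
    ∃ β₁ : ℝ, ∀ β : ℝ, β₁ ≤ β → ∀ (b k : ℕ) (δ : ℝ), 1 ≤ b →
      ((2 * k + 1 : ℕ) : ℝ) * (96 * (b : ℝ) ^ 4) * 3750 ^ (2 * k) * Real.exp (-(θ / 12 * β)) ^ (k + 1) ≤ δ →
        ∀ w : Fin 4 → ℤ → ℤ, IsFrame b w → ClauseIII r.ρ β w b δ (TypCluster r.ρ θ w k) := by
  classical
  obtain ⟨β₁, hβ₁1, hsp⟩ := torus_plaqSet_sparse_exp (G := G) r hθ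
  refine ⟨β₁, fun β hβ b k δ hb hbudget w hw S hS F _ hin => ?_⟩
  have hS1 : 1 ≤ S := by omega
  set q : ℝ := Real.exp (-(θ / 12 * β)) with hq
  have hq0 : 0 ≤ q := (Real.exp_pos _).le
  have hq1 : q ≤ 1 := by
    rw [hq, Real.exp_le_one_iff, neg_nonpos]
    have hβ0 : 0 ≤ β := le_trans zero_le_one (hβ₁1.trans hβ)
    positivity
  have hP𝒰 : ∀ c ∈ F, cellPlaqs w c ⊆ F.biUnion (cellPlaqs w) := fun c hc => Finset.subset_biUnion_of_mem _ hc
  have hdisj : ∀ c ∈ F, ∀ c' ∈ F, c ≠ c' → Disjoint (cellPlaqs w c) (cellPlaqs w c') :=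
    fun c _ c' _ hcc => disjoint_cellPlaqs hw hcc
  have hn : ∀ c ∈ F, (cellPlaqs w c).card ≤ 96 * b ^ 4 := fun c _ => by
    have h := card_cellPlaqs_le hw c
    rw [card_orient_four] at h
    calc (cellPlaqs w c).card ≤ (2 * b) ^ 4 * 6 := h
      _ = 96 * b ^ 4 := by ring
  have hsp' : ∀ X : Finset (ZdPlaquette 4), X ⊆ F.biUnion (cellPlaqs w) →
      (wilsonMeasure (d := 4) (L := 2 * S + 1) r.ρ β)
          {V : GaugeConfig 4 (2 * S + 1) G | ∀ p ∈ X, θ ≤ plaqAction r.ρ p (torusLift (2 * S + 1) V)} ≤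
        ENNReal.ofReal (q ^ X.card) := by
    intro X hX
    refine hsp β hβ S hS1 X fun p hp => ?_
    obtain ⟨c, hc, hpc⟩ := Finset.mem_biUnion.1 (hX hp)
    exact cellSites_subset_box (hin c hc) _ (fst_mem_cellSites_of_mem_cellPlaqs hpc)
  have hmain := measure_forall_hasBadClusterAmong_le_pow r.ρ (wilsonMeasure (d := 4) (L := 2 * S + 1) r.ρ β)
    (torusLift (2 * S + 1)) θ F (cellPlaqs w) (F.biUnion (cellPlaqs w)) hP𝒰 hdisj hn hq0 hq1 hsp' k
  have hev : {V : GaugeConfig 4 (2 * S + 1) G | ∀ c ∈ F, torusLift (2 * S + 1) V ∉ TypCluster r.ρ θ w k c} =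
      {V | ∀ c ∈ F, HasBadClusterAmong r.ρ θ (↑(cellPlaqs w c)) k (torusLift (2 * S + 1) V)} := by
    ext V
    simp only [Set.mem_setOf_eq, TypCluster, not_not]
  rw [hev]
  refine hmain.trans (ENNReal.ofReal_le_ofReal (pow_le_pow_left₀ (by positivity) ?_ _))
  calc ((2 * k + 1 : ℕ) : ℝ) * ((96 * b ^ 4 : ℕ) : ℝ) * 3750 ^ (2 * k) * q ^ (k + 1)
      = ((2 * k + 1 : ℕ) : ℝ) * (96 * (b : ℝ) ^ 4) * 3750 ^ (2 * k) * q ^ (k + 1) := by push_cast; ring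
    _ ≤ δ := hbudget

/-- **Budget arithmetic for the count class.**  For a rate `κ > 0`, a mesh growth `C`, a count `k ≥ 4C⁺/κ` and any prefactor `A`: for every `δ > 0`
and every `B` there is `β₂` such that `A · b⁴ · (e^{−κβ})^{k+1} ≤ δ` for all `β ≥ β₂` and all meshes `b ≤ B e^{Cβ}` (`e^{4C⁺β} (e^{−κβ})^{k+1} ≤ e^{−κβ}`). -/
theorem clusterBudget {κ : ℝ} (hκ : 0 < κ) (C : ℝ) {k : ℕ} (hk : 4 * max C 0 / κ ≤ k) (A : ℝ) :
    ∀ δ : ℝ, 0 < δ → ∀ B : ℝ, ∃ β₂ : ℝ, ∀ β : ℝ, β₂ ≤ β → ∀ b : ℕ, (b : ℝ) ≤ B * Real.exp (C * β) →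
      A * (b : ℝ) ^ 4 * Real.exp (-(κ * β)) ^ (k + 1) ≤ δ := by
  intro δ hδ B
  set C' : ℝ := max C 0 with hC'
  have hC'0 : 0 ≤ C' := le_max_right _ _
  set B' : ℝ := max B 1 with hB'
  have hB'0 : 0 ≤ B' := le_trans zero_le_one (le_max_right _ _)
  set A' : ℝ := max A 1 with hA'
  have hA'0 : 0 < A' := lt_of_lt_of_le zero_lt_one (le_max_right _ _)
  set M : ℝ := A' * B' ^ 4 with hM
  have hM0 : 0 < M := by positivity
  refine ⟨max 0 (Real.log (M / δ) / κ), fun β hβ b hbB => ?_⟩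
  have hβ0 : 0 ≤ β := le_trans (le_max_left _ _) hβ
  have hβM : Real.log (M / δ) / κ ≤ β := le_trans (le_max_right _ _) hβ
  set q : ℝ := Real.exp (-(κ * β)) with hq
  have hq0 : 0 < q := Real.exp_pos _
  -- `b ≤ B' e^{C' β}`, `b⁴ ≤ B'^4 e^{4C'β}`
  have hbB' : (b : ℝ) ≤ B' * Real.exp (C' * β) := by
    refine hbB.trans ?_
    rcases le_or_gt B 0 with hB0 | hB0
    · exact le_trans (mul_nonpos_iff.2 (Or.inr ⟨hB0, (Real.exp_pos _).le⟩)) (by positivity)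
    · exact mul_le_mul (le_max_left _ _)
        (Real.exp_le_exp.2 (mul_le_mul_of_nonneg_right (le_max_left C 0) hβ0)) (Real.exp_pos _).le hB'0
  have hb0 : (0 : ℝ) ≤ b := Nat.cast_nonneg _
  have hb4 : (b : ℝ) ^ 4 ≤ B' ^ 4 * Real.exp (4 * C' * β) := by
    calc (b : ℝ) ^ 4 ≤ (B' * Real.exp (C' * β)) ^ 4 := pow_le_pow_left₀ hb0 hbB' 4
      _ = B' ^ 4 * Real.exp (4 * C' * β) := by
        rw [mul_pow, ← Real.exp_nat_mul]
        congr 2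
        push_cast
        ring
  -- rate comparison: `e^{4C'β} q^{k+1} ≤ q` since `4 C'/κ ≤ k`
  have hrate : Real.exp (4 * C' * β) * q ^ (k + 1) ≤ q := by
    rw [hq, ← Real.exp_nat_mul, ← Real.exp_add]
    refine Real.exp_le_exp.2 ?_
    have h1 : 4 * C' ≤ (k : ℝ) * κ := (div_le_iff₀ hκ).1 hk
    have h2 : 0 ≤ ((k : ℝ) * κ - 4 * C') * β := mul_nonneg (by linarith) hβ0
    push_cast
    nlinarith
  -- `M q ≤ δ` from `β ≥ log (M/δ) / κ`
  have hMq : M * q ≤ δ := by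
    have hκβ : Real.log (M / δ) ≤ κ * β := by
      have := (div_le_iff₀ hκ).1 hβM
      linarith [mul_comm β κ]
    have h1 : -(κ * β) ≤ Real.log (δ / M) := by
      rw [Real.log_div hδ.ne' hM0.ne']
      rw [Real.log_div hM0.ne' hδ.ne'] at hκβ
      linarith
    have h2 : q ≤ δ / M := by
      rw [hq, ← Real.exp_log (div_pos hδ hM0)]
      exact Real.exp_le_exp.2 h1
    rwa [le_div_iff₀ hM0, mul_comm] at h2
  have hA : A ≤ A' := le_max_left _ _
  have hqk0 : 0 ≤ q ^ (k + 1) := pow_nonneg hq0.le _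
  calc A * (b : ℝ) ^ 4 * q ^ (k + 1) ≤ A' * (b : ℝ) ^ 4 * q ^ (k + 1) := by gcongr
    _ ≤ A' * (B' ^ 4 * Real.exp (4 * C' * β)) * q ^ (k + 1) := by gcongr
    _ = M * (Real.exp (4 * C' * β) * q ^ (k + 1)) := by rw [hM]; ring
    _ ≤ M * q := by gcongr
    _ ≤ δ := hMq

/-- **Clause (iii) for `TypCluster` in the SUPPLIER'S QUANTIFIER ORDER, exponential meshes (PROVED).**  For `θ > 0`, a growth rate `C` and EVERY count
`k ≥ halfExtent (θ/12) C = ⌈48 C⁺/θ⌉₊`: for every `δ > 0` and prefactor `B` there is `β₂` with `ClauseIII r.ρ β w b δ (TypCluster r.ρ θ w k)` for all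
`β ≥ β₂`, all meshes `1 ≤ b ≤ B e^{Cβ}` and all mesh-`b` frames `w`. -/
theorem clauseIII_typCluster_expMesh (r : LatticeRep G) {θ : ℝ} (hθ : 0 < θ) (C : ℝ) {k : ℕ} (hk : halfExtent (θ / 12) C ≤ k) :
    ∀ δ : ℝ, 0 < δ → ∀ B : ℝ, ∃ β₂ : ℝ, ∀ β : ℝ, β₂ ≤ β → ∀ b : ℕ, 1 ≤ b →
      (b : ℝ) ≤ B * Real.exp (C * β) → ∀ w : Fin 4 → ℤ → ℤ, IsFrame b w → ClauseIII r.ρ β w b δ (TypCluster r.ρ θ w k) := by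
  intro δ hδ B
  obtain ⟨β₁, h⟩ := clauseIII_typCluster (G := G) r hθ
  have hk' : 4 * max C 0 / (θ / 12) ≤ k := (Nat.le_ceil _).trans (by exact_mod_cast hk)
  obtain ⟨β₂, hb⟩ := clusterBudget (κ := θ / 12) (by positivity) C hk' (((2 * k + 1 : ℕ) : ℝ) * 96 * 3750 ^ (2 * k)) δ hδ B
  refine ⟨max β₁ β₂, fun β hβ b hb1 hbB w hw => h β (le_trans (le_max_left _ _) hβ) b k δ hb1 ?_ w hw⟩
  have := hb β (le_trans (le_max_right _ _) hβ) b hbB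
  calc ((2 * k + 1 : ℕ) : ℝ) * (96 * (b : ℝ) ^ 4) * 3750 ^ (2 * k) * Real.exp (-(θ / 12 * β)) ^ (k + 1)
      = ((2 * k + 1 : ℕ) : ℝ) * 96 * 3750 ^ (2 * k) * (b : ℝ) ^ 4 * Real.exp (-(θ / 12 * β)) ^ (k + 1) := by ring
    _ ≤ δ := this

end Torus

end Summit.QuantumFields.YangMills.Cruxes.IR.AfPincerUc.SharpLanes

end
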